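import Mathlib
import Literature.Analysis.FluidPDE.AxisDistancePowerIntegral
import Literature.Analysis.FluidPDE.CylindricalIntegration
import Literature.Analysis.FluidPDE.AxisymShellLadyzhenskaya
import Literature.Analysis.FluidPDE.AxisymmetricEuler
import HarnessLib.Audit

/-!
# Crux E `PowerGaugeEulerLiouville` (stmt-NavierStokesRegularity-19832), line `swirl-capacity`, stub D2 — part 2:
# MERIDIONAL REDUCTION (the weighted Dirichlet energy and the volume of a superlevel blob of an AXISYMMETRIC scalar, read on the
# meridional half-plane)

Route `EulerZoomLiouville` (NavierStokesRegularity), crux E.  Line `swirl-capacity` (ns-idea-11 g3, LINE D), stub D2 (power-lossy form,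
critic V29 P3).  For an axisymmetric scalar `f` on `ℝ³` write `m(z, ρ) = (ρ, 0, z)` for the meridional point; every point of `ℝ³` off the axis is
`R_θ m(z, ρ)` (`cylindricalPt_eq_rotZ`), and `f`, `‖∇f‖` are `R_θ`-invariant.  Tonelli in cylindrical coordinates
(`Literature.Analysis.FluidPDE.lintegral_eq_lintegral_cylindrical`) then gives:

* `meridional_energy_le` — `2π ∫_{|z| ≤ 2A, 0 < ρ ≤ 2A} ‖∇f(m(z,ρ))‖²/ρ d(z,ρ) ≤ ∫_{B(0,3A)} ‖∇f‖²/r² dx`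
  (the solid cylinder `{r ≤ 2A, |x₂| ≤ 2A}` lies inside `B(0, 3A)`);
* `volume_le_meridional_section` — a measurable `T ⊆ B(0, A)` on which `f ≥ γ₀` has
  `|T| ≤ 2πA · |{(z,ρ) : |z| ≤ A, 0 < ρ ≤ A, f(m(z,ρ)) ≥ γ₀}|`.

Both are stated with lower Lebesgue integrals on `ℝ × ℝ` (Lebesgue measure), the plane in which part 1's Sobolev floor lives.

WHAT THIS IS NOT: not NS regularity, not the crux E — helper real analysis `--supports` stmt-19832.  [folklore; EvansGariepy2015 §3.4.4 (polar
coordinates)]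
-/

noncomputable section

set_option linter.dupNamespace false

open MeasureTheory Set Filter Topology Metric Function
open scoped NNReal ENNReal

namespace Summit.NavierStokesRegularity.NavierStokesRegularity.Theorems.PowerGaugeEulerLiouville.SwirlCapacity

open Literature.Analysis Literature.Analysis.FluidPDE

/-! ### Meridional points -/

/-- The cylindrical point `(ρ cos θ, ρ sin θ, z)` is the rotation `R_θ` of the meridional point `(ρ, 0, z)`. [folklore] -/
theorem cylindricalPt_eq_rotZ (ρ θ z : ℝ) :
    (WithLp.toLp 2 ![ρ * Real.cos θ, ρ * Real.sin θ, z] : EuclideanSpace ℝ (Fin 3)) =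
      rotZ θ (WithLp.toLp 2 ![ρ, 0, z]) := by
  ext i
  fin_cases i <;> simp [rotZ] <;> ring

/-- The cylindrical radius of `(ρ cos θ, ρ sin θ, z)` is `|ρ|` (private plumbing, as in `AxisDistancePowerIntegral`). [folklore] -/
private theorem cylRadius_cylindricalPt (ρ θ z : ℝ) :
    cylRadius (WithLp.toLp 2 ![ρ * Real.cos θ, ρ * Real.sin θ, z] : EuclideanSpace ℝ (Fin 3)) = |ρ| := by
  -- adapted from Literature/Analysis/FluidPDE/AxisDistancePowerIntegral.lean
  rw [cylRadius]
  have e : (ρ * Real.cos θ) ^ 2 + (ρ * Real.sin θ) ^ 2 = ρ ^ 2 := by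
    linear_combination ρ ^ 2 * Real.sin_sq_add_cos_sq θ
  simp only [Matrix.cons_val_zero, Matrix.cons_val_one]
  rw [e, Real.sqrt_sq_eq_abs]

/-- An axisymmetric scalar takes the same value at `(ρ cos θ, ρ sin θ, z)` and at the meridional point `(ρ, 0, z)`. [folklore] -/
theorem apply_cylindricalPt_of_isAxisymmetricScalar {α : Sort*} {f : EuclideanSpace ℝ (Fin 3) → α} (hf : IsAxisymmetricScalar f)
    (ρ θ z : ℝ) : f (WithLp.toLp 2 ![ρ * Real.cos θ, ρ * Real.sin θ, z]) = f (WithLp.toLp 2 ![ρ, 0, z]) := by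
  rw [cylindricalPt_eq_rotZ, hf θ]

/-- The solid cylinder `{r ≤ 2A, |x₂| ≤ 2A}` lies in the ball `B(0, 3A)` (`8A² < 9A²`). [folklore] -/
theorem solidCylinder_two_subset_ball {A : ℝ} (hA : 0 < A) :
    solidCylinder (2 * A) (2 * A) ⊆ ball (0 : EuclideanSpace ℝ (Fin 3)) (3 * A) := by
  intro x hx
  obtain ⟨hr, hz⟩ := hx
  rw [mem_ball, dist_zero_right]
  have hr0 := cylRadius_nonneg x
  have hsq : ‖x‖ ^ 2 = cylRadius x ^ 2 + x 2 ^ 2 := by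
    rw [EuclideanSpace.norm_eq, Real.sq_sqrt (by positivity), Fin.sum_univ_three, cylRadius_sq]
    simp only [Real.norm_eq_abs, sq_abs]
  have h1 : cylRadius x ^ 2 ≤ (2 * A) ^ 2 := pow_le_pow_left₀ hr0 hr 2
  have h2 : x 2 ^ 2 ≤ (2 * A) ^ 2 := by
    rw [← sq_abs]; exact pow_le_pow_left₀ (abs_nonneg _) hz 2
  have h3 : ‖x‖ ^ 2 < (3 * A) ^ 2 := by nlinarith
  exact (pow_lt_pow_iff_left₀ (norm_nonneg _) (by positivity) two_ne_zero).1 h3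

/-! ### The weighted energy on the meridional half-square -/

/-- **MERIDIONAL ENERGY BOUND.**  For a `C¹` axisymmetric scalar `f` and `A > 0`:
`2π ∫_{[−2A,2A] × (0,2A]} ‖∇f(ρ,0,z)‖²/ρ d(z,ρ) ≤ ∫_{B(0,3A)} ‖∇f‖²/r² dx` (Tonelli in cylindrical coordinates on the solid cylinder
`{r ≤ 2A, |x₂| ≤ 2A} ⊆ B(0,3A)`, and `‖∇f(R_θ x)‖ = ‖∇f(x)‖`). [cite: EvansGariepy2015, §3.4.4 (polar coordinates, with Fubini §1.4)] -/
theorem meridional_energy_le {f : EuclideanSpace ℝ (Fin 3) → ℝ} (hf : IsAxisymmetricScalar f) (hfd : ContDiff ℝ 1 f)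
    {A : ℝ} (hA : 0 < A) :
    ENNReal.ofReal (2 * Real.pi) * ∫⁻ y in Icc (-(2 * A)) (2 * A) ×ˢ Ioc (0 : ℝ) (2 * A),
        ENNReal.ofReal (‖fderiv ℝ f (WithLp.toLp 2 ![y.2, 0, y.1])‖ ^ 2 / y.2) ≤
      ∫⁻ x in ball (0 : EuclideanSpace ℝ (Fin 3)) (3 * A), ENNReal.ofReal (‖fderiv ℝ f x‖ ^ 2 / cylRadius x ^ 2) := by
  -- adapted from Literature/Analysis/FluidPDE/AxisDistancePowerIntegral.lean (`lintegral_inv_cylRadius_rpow_axisCylinder_le`)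
  have hnorm : IsAxisymmetricScalar fun x => ‖fderiv ℝ f x‖ := hf.norm_fderiv (hfd.differentiable one_ne_zero)
  set S : Set (EuclideanSpace ℝ (Fin 3)) := solidCylinder (2 * A) (2 * A) with hS
  have hSm : MeasurableSet S := measurableSet_solidCylinder _ _
  set F : EuclideanSpace ℝ (Fin 3) → ℝ≥0∞ := fun x => ENNReal.ofReal (‖fderiv ℝ f x‖ ^ 2 / cylRadius x ^ 2) with hF
  have hFm : Measurable F :=
    ENNReal.measurable_ofReal.comp
      (((hfd.continuous_fderiv one_ne_zero).norm.pow 2).measurable.div (continuous_cylRadius.measurable.pow_const 2))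
  -- the meridional integrand
  set G : ℝ × ℝ → ℝ≥0∞ := fun y => ENNReal.ofReal (‖fderiv ℝ f (WithLp.toLp 2 ![y.2, 0, y.1])‖ ^ 2 / y.2) with hG
  have hmerid : Continuous fun y : ℝ × ℝ => (WithLp.toLp 2 ![y.2, 0, y.1] : EuclideanSpace ℝ (Fin 3)) := by
    refine (PiLp.continuous_toLp 2 _).comp (continuous_pi fun i => ?_)
    fin_cases i
    · exact continuous_snd
    · exact continuous_const
    · exact continuous_fst
  have hGm : Measurable G :=
    ENNReal.measurable_ofReal.comp
      ((((hfd.continuous_fderiv one_ne_zero).comp hmerid).norm.pow 2).measurable.div measurable_snd)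
  set I₁ : ℝ → ℝ≥0∞ := (Icc (-(2 * A)) (2 * A)).indicator 1 with hI₁
  have hI₁m : Measurable I₁ := measurable_one.indicator measurableSet_Icc
  -- the integrand in cylindrical coordinates
  have hpt : ∀ (z θ : ℝ), ∀ ρ ∈ Ioi (0 : ℝ), ENNReal.ofReal ρ *
      S.indicator F (WithLp.toLp 2 ![ρ * Real.cos θ, ρ * Real.sin θ, z]) = I₁ z * (Iic (2 * A)).indicator (fun ρ => G (z, ρ)) ρ := by
    intro z θ ρ hρ
    have hρ0 : 0 < ρ := hρ
    have hrad : cylRadius (WithLp.toLp 2 ![ρ * Real.cos θ, ρ * Real.sin θ, z] : EuclideanSpace ℝ (Fin 3)) = ρ := by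
      rw [cylRadius_cylindricalPt, abs_of_pos hρ0]
    have hmem : (WithLp.toLp 2 ![ρ * Real.cos θ, ρ * Real.sin θ, z] : EuclideanSpace ℝ (Fin 3)) ∈ S ↔
        ρ ≤ 2 * A ∧ z ∈ Icc (-(2 * A)) (2 * A) := by
      simp only [hS, solidCylinder, mem_setOf_eq, hrad, mem_Icc, abs_le]
      rfl
    have hFpt : F (WithLp.toLp 2 ![ρ * Real.cos θ, ρ * Real.sin θ, z]) =
        ENNReal.ofReal (‖fderiv ℝ f (WithLp.toLp 2 ![ρ, 0, z])‖ ^ 2 / ρ ^ 2) := by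
      simp only [hF, hrad]
      rw [show ‖fderiv ℝ f (WithLp.toLp 2 ![ρ * Real.cos θ, ρ * Real.sin θ, z])‖ =
          ‖fderiv ℝ f (WithLp.toLp 2 ![ρ, 0, z])‖ from apply_cylindricalPt_of_isAxisymmetricScalar hnorm ρ θ z]
    by_cases hz : z ∈ Icc (-(2 * A)) (2 * A)
    · by_cases hρr : ρ ≤ 2 * A
      · rw [indicator_of_mem (hmem.2 ⟨hρr, hz⟩), hI₁, indicator_of_mem hz,
          indicator_of_mem (show ρ ∈ Iic (2 * A) from hρr), Pi.one_apply, one_mul, hFpt, hG]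
        simp only
        rw [← ENNReal.ofReal_mul hρ0.le]
        congr 1
        field_simp
      · rw [indicator_of_notMem (fun hm => hρr (hmem.1 hm).1),
          indicator_of_notMem (show ρ ∉ Iic (2 * A) from hρr), mul_zero, mul_zero]
    · rw [indicator_of_notMem (fun hm => hz (hmem.1 hm).2), hI₁, indicator_of_notMem hz, zero_mul, mul_zero]
  -- the inner integral
  have hinner : ∀ z θ : ℝ, ∫⁻ ρ in Ioi (0 : ℝ), ENNReal.ofReal ρ *
      S.indicator F (WithLp.toLp 2 ![ρ * Real.cos θ, ρ * Real.sin θ, z]) = I₁ z * ∫⁻ ρ in Ioc 0 (2 * A), G (z, ρ) := by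
    intro z θ
    have hGz : Measurable fun ρ => G (z, ρ) := hGm.comp (measurable_const.prodMk measurable_id)
    rw [setLIntegral_congr_fun measurableSet_Ioi (hpt z θ), lintegral_const_mul _ (hGz.indicator measurableSet_Iic),
      lintegral_indicator measurableSet_Iic, Measure.restrict_restrict measurableSet_Iic, Iic_inter_Ioi]
  -- the left-hand side as an iterated integral
  have hL : ∫⁻ y in Icc (-(2 * A)) (2 * A) ×ˢ Ioc (0 : ℝ) (2 * A), G y = ∫⁻ z, I₁ z * ∫⁻ ρ in Ioc 0 (2 * A), G (z, ρ) := by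
    have hμ : ((volume : Measure ℝ).restrict (Icc (-(2 * A)) (2 * A))).prod ((volume : Measure ℝ).restrict (Ioc 0 (2 * A))) =
        (volume : Measure (ℝ × ℝ)).restrict (Icc (-(2 * A)) (2 * A) ×ˢ Ioc 0 (2 * A)) := by
      rw [Measure.prod_restrict, ← Measure.volume_eq_prod]
    rw [← hμ, lintegral_prod _ hGm.aemeasurable, ← lintegral_indicator measurableSet_Icc]
    refine lintegral_congr fun z => ?_
    by_cases hz : z ∈ Icc (-(2 * A)) (2 * A)
    · rw [indicator_of_mem hz, hI₁, indicator_of_mem hz, Pi.one_apply, one_mul]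
    · rw [indicator_of_notMem hz, hI₁, indicator_of_notMem hz, zero_mul]
  -- assemble
  calc ENNReal.ofReal (2 * Real.pi) * ∫⁻ y in Icc (-(2 * A)) (2 * A) ×ˢ Ioc (0 : ℝ) (2 * A), G y
      = ∫⁻ z : ℝ, ∫⁻ _θ in Ioo (-Real.pi) Real.pi, I₁ z * ∫⁻ ρ in Ioc 0 (2 * A), G (z, ρ) := by
        rw [hL]
        simp_rw [setLIntegral_const, Real.volume_Ioo, show Real.pi - -Real.pi = 2 * Real.pi by ring]
        rw [← lintegral_const_mul' _ _ ENNReal.ofReal_ne_top]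
        refine lintegral_congr fun z => ?_
        ring
    _ = ∫⁻ z : ℝ, ∫⁻ θ in Ioo (-Real.pi) Real.pi, ∫⁻ ρ in Ioi (0 : ℝ),
          ENNReal.ofReal ρ * S.indicator F (WithLp.toLp 2 ![ρ * Real.cos θ, ρ * Real.sin θ, z]) := by
        simp_rw [hinner]
    _ = ∫⁻ x, S.indicator F x := (lintegral_eq_lintegral_cylindrical (hFm.indicator hSm)).symm
    _ = ∫⁻ x in S, F x := lintegral_indicator hSm _
    _ ≤ ∫⁻ x in ball (0 : EuclideanSpace ℝ (Fin 3)) (3 * A), F x := lintegral_mono_set (solidCylinder_two_subset_ball hA)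

/-! ### The volume of a superlevel blob via its meridional section -/

/-- **VOLUME VIA THE MERIDIONAL SECTION.**  For an axisymmetric continuous scalar `f`, a set `T ⊆ B(0, A)` on which `f ≥ γ₀` has
`|T| ≤ 2πA · |{(z,ρ) ∈ [−A,A] × (0,A] : f(ρ,0,z) ≥ γ₀}|` (Tonelli in cylindrical coordinates; the Jacobian `ρ ≤ A`). [folklore] -/
theorem volume_le_meridional_section {f : EuclideanSpace ℝ (Fin 3) → ℝ} (hf : IsAxisymmetricScalar f) (hfc : Continuous f)
    {A γ₀ : ℝ} (hA : 0 < A) {T : Set (EuclideanSpace ℝ (Fin 3))} (hT : T ⊆ ball (0 : EuclideanSpace ℝ (Fin 3)) A)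
    (hγT : ∀ x ∈ T, γ₀ ≤ f x) :
    volume T ≤ ENNReal.ofReal (2 * Real.pi * A) *
      volume {y : ℝ × ℝ | y ∈ Icc (-A) A ×ˢ Ioc (0 : ℝ) A ∧ γ₀ ≤ f (WithLp.toLp 2 ![y.2, 0, y.1])} := by
  -- the axisymmetric superlevel cylinder containing `T`
  set U : Set (EuclideanSpace ℝ (Fin 3)) := {x | x ∈ solidCylinder A A ∧ γ₀ ≤ f x} with hU
  have hUm : MeasurableSet U := (measurableSet_solidCylinder _ _).inter (isClosed_le continuous_const hfc).measurableSet
  have hTU : T ⊆ U := by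
    intro x hx
    refine ⟨closedBall_subset_solidCylinder A (ball_subset_closedBall (hT hx)), hγT x hx⟩
  -- the meridional section
  set Sec : Set (ℝ × ℝ) := {y : ℝ × ℝ | y ∈ Icc (-A) A ×ˢ Ioc (0 : ℝ) A ∧ γ₀ ≤ f (WithLp.toLp 2 ![y.2, 0, y.1])} with hSec
  have hmerid : Continuous fun y : ℝ × ℝ => (WithLp.toLp 2 ![y.2, 0, y.1] : EuclideanSpace ℝ (Fin 3)) := by
    refine (PiLp.continuous_toLp 2 _).comp (continuous_pi fun i => ?_)
    fin_cases i
    · exact continuous_snd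
    · exact continuous_const
    · exact continuous_fst
  have hSecm : MeasurableSet Sec :=
    (measurableSet_Icc.prod measurableSet_Ioc).inter (isClosed_le continuous_const (hfc.comp hmerid)).measurableSet
  set J : ℝ × ℝ → ℝ≥0∞ := Sec.indicator 1 with hJ
  have hJm : Measurable J := measurable_one.indicator hSecm
  -- the integrand in cylindrical coordinates
  have hpt : ∀ (z θ : ℝ), ∀ ρ ∈ Ioi (0 : ℝ), ENNReal.ofReal ρ *
      U.indicator 1 (WithLp.toLp 2 ![ρ * Real.cos θ, ρ * Real.sin θ, z]) ≤ ENNReal.ofReal A * J (z, ρ) := by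
    intro z θ ρ hρ
    have hρ0 : 0 < ρ := hρ
    have hrad : cylRadius (WithLp.toLp 2 ![ρ * Real.cos θ, ρ * Real.sin θ, z] : EuclideanSpace ℝ (Fin 3)) = ρ := by
      rw [cylRadius_cylindricalPt, abs_of_pos hρ0]
    by_cases hm : (WithLp.toLp 2 ![ρ * Real.cos θ, ρ * Real.sin θ, z] : EuclideanSpace ℝ (Fin 3)) ∈ U
    · have hm' := hm
      obtain ⟨⟨h1, h2⟩, h3⟩ := hm'
      rw [hrad] at h1
      have h2' : |z| ≤ A := h2
      rw [apply_cylindricalPt_of_isAxisymmetricScalar hf] at h3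
      have hyS : (z, ρ) ∈ Sec := ⟨⟨abs_le.1 h2', hρ0, h1⟩, h3⟩
      rw [indicator_of_mem hm, hJ, indicator_of_mem hyS, Pi.one_apply, Pi.one_apply, mul_one, mul_one]
      exact ENNReal.ofReal_le_ofReal h1
    · rw [indicator_of_notMem hm, mul_zero]
      exact zero_le
  calc volume T ≤ volume U := measure_mono hTU
    _ = ∫⁻ x, U.indicator 1 x := (lintegral_indicator_one hUm).symm
    _ = ∫⁻ z : ℝ, ∫⁻ θ in Ioo (-Real.pi) Real.pi, ∫⁻ ρ in Ioi (0 : ℝ),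
          ENNReal.ofReal ρ * U.indicator 1 (WithLp.toLp 2 ![ρ * Real.cos θ, ρ * Real.sin θ, z]) :=
        lintegral_eq_lintegral_cylindrical (measurable_one.indicator hUm)
    _ ≤ ∫⁻ z : ℝ, ∫⁻ _θ in Ioo (-Real.pi) Real.pi, ∫⁻ ρ in Ioi (0 : ℝ), ENNReal.ofReal A * J (z, ρ) := by
        refine lintegral_mono fun z => lintegral_mono fun θ => setLIntegral_mono' measurableSet_Ioi (hpt z θ)
    _ ≤ ∫⁻ z : ℝ, ∫⁻ _θ in Ioo (-Real.pi) Real.pi, ∫⁻ ρ, ENNReal.ofReal A * J (z, ρ) := by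
        refine lintegral_mono fun z => lintegral_mono fun θ => setLIntegral_le_lintegral _ _
    _ = ENNReal.ofReal (2 * Real.pi * A) * ∫⁻ z : ℝ, ∫⁻ ρ, J (z, ρ) := by
        have hJz : ∀ z : ℝ, Measurable fun ρ => J (z, ρ) := fun z => hJm.comp (measurable_const.prodMk measurable_id)
        simp_rw [lintegral_const_mul _ (hJz _), setLIntegral_const, Real.volume_Ioo,
          show Real.pi - -Real.pi = 2 * Real.pi by ring]
        rw [← lintegral_const_mul' _ _ ENNReal.ofReal_ne_top]
        refine lintegral_congr fun z => ?_
        rw [show 2 * Real.pi * A = A * (2 * Real.pi) by ring, ENNReal.ofReal_mul hA.le]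
        ring
    _ = ENNReal.ofReal (2 * Real.pi * A) * volume Sec := by
        rw [Measure.volume_eq_prod, ← lintegral_prod _ (by rw [← Measure.volume_eq_prod]; exact hJm.aemeasurable), hJ,
          ← Measure.volume_eq_prod, lintegral_indicator_one hSecm]

end Summit.NavierStokesRegularity.NavierStokesRegularity.Theorems.PowerGaugeEulerLiouville.SwirlCapacity

end
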